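import Summits.Ventures.PercRepro.ProfileGapMonoThresholdThreeLinesNullity

/-!
# PercRepro — THE OPEN CORE OF THE CO-RANK-3 THRESHOLD FAMILY IS A LINE OF EXACTLY `ν + 1` POINTS WHOSE
COMPLEMENT IS A SERIES CLASS (p5, gen 29; `proofs/P5-GM1.md` §37; announced INBOX 13715)

For a rank-`2` flat `F` of a finite matroid, `ρ(E) ≤ ρ(F) + #(E ∖ F)` gives `#F + ρ(E) ≤ #E + 2`
(`card_clF_add_rk_le`), i.e. a line has at most `ν(N) + 2` points; with equality every outside point is a coloop
(`coloop_of_card_add_rk_eq`), so on a coloop-free matroid a line with `ν + 2` points is the whole ground set.  Since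
lines of at most `ν` points are covered by `thresholdIneq_three_of_line_card_le_nullity`, the co-rank-`3` threshold
family can only fail on a coloop-free matroid with a line of EXACTLY `ν + 1` points
(`thresholdIneq_three_of_no_long_line`).  Such a line `ℓ` has a rigid complement `O = E ∖ ℓ` (`#O = ρ(E) − 1`):
every two outside points form a cocircuit (`rk_sdiff_pair_of_long_line`: `ρ(E ∖ {x, y}) + 1 = ρ(E)`), and for every
`x ∈ O` the set `O ∖ x` is independent and skew to `ℓ` (`rk_sdiff_erase_of_long_line`, `rk_union_erase_of_long_line`)
— `O` is a series class and `N` is a series extension of a rank-`2` matroid.  Nothing open is asserted.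
-/

open scoped Matroid

namespace PercRepro.Cogirth

open Finset ThmH Skew Shadow Profile

variable {α : Type} [DecidableEq α] {N : Matroid α} [N.Finite]

section LongLine

variable {t : ℕ}

/-- **A rank-`2` flat has at most `ν + 2` points**: `#(cl B) + ρ(E) ≤ #E + 2` for every rank-`2` set `B`
(`ρ(E) ≤ ρ(cl B) + ρ(E ∖ cl B) ≤ 2 + #(E ∖ cl B)`). -/
theorem card_clF_add_rk_le {B : Finset α} (hB : B ∈ Rq N 2) :
    (clF N B).card + rk N (gr N) ≤ (gr N).card + 2 := by
  have hBrk : rk N B = 2 := rk_eq_of_eRk_eq_cq (mem_Rq.1 hB).2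
  have hclg : clF N B ⊆ gr N := clF_subset_gr B
  have hsplit : gr N = clF N B ∪ (gr N \ clF N B) := (union_sdiff_of_subset hclg).symm
  have h1 : rk N (gr N) ≤ rk N (clF N B) + rk N (gr N \ clF N B) := by
    calc rk N (gr N) = rk N (clF N B ∪ (gr N \ clF N B)) := by rw [← hsplit]
      _ ≤ _ := rk_union_le _ _
  have h2 : rk N (gr N \ clF N B) ≤ (gr N \ clF N B).card := rk_le_card _
  have h3 : (gr N \ clF N B).card = (gr N).card - (clF N B).card := card_sdiff_of_subset hclg
  have h4 : (clF N B).card ≤ (gr N).card := card_le_card hclg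
  rw [rk_clF, hBrk] at h1
  omega

/-- **A line with `ν + 2` points makes every outside point a coloop**: if `#(cl B) + ρ(E) = #E + 2`, then
`ρ(E ∖ z) + 1 = ρ(E)` for every `z ∉ cl B` (`ρ(E ∖ z) ≤ 2 + #(E ∖ cl B) − 1`). -/
theorem coloop_of_card_add_rk_eq {B : Finset α} (hB : B ∈ Rq N 2)
    (heq : (clF N B).card + rk N (gr N) = (gr N).card + 2) {z : α} (hz : z ∈ gr N \ clF N B) :
    rk N ((gr N).erase z) + 1 = rk N (gr N) := by
  have hBrk : rk N B = 2 := rk_eq_of_eRk_eq_cq (mem_Rq.1 hB).2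
  have hclg : clF N B ⊆ gr N := clF_subset_gr B
  have hsub : (gr N).erase z ⊆ clF N B ∪ ((gr N \ clF N B).erase z) := by
    intro y hy
    rw [mem_erase] at hy
    by_cases hycl : y ∈ clF N B
    · exact mem_union_left _ hycl
    · exact mem_union_right _ (mem_erase.2 ⟨hy.1, mem_sdiff.2 ⟨hy.2, hycl⟩⟩)
  have h1 : rk N ((gr N).erase z) ≤ rk N (clF N B) + rk N ((gr N \ clF N B).erase z) :=
    (rk_mono' hsub).trans (rk_union_le _ _)
  have h2 : rk N ((gr N \ clF N B).erase z) ≤ ((gr N \ clF N B).erase z).card := rk_le_card _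
  have h3 : ((gr N \ clF N B).erase z).card = (gr N \ clF N B).card - 1 := card_erase_of_mem hz
  have h4 : (gr N \ clF N B).card = (gr N).card - (clF N B).card := card_sdiff_of_subset hclg
  have h5 : (clF N B).card ≤ (gr N).card := card_le_card hclg
  have h6 : 0 < (gr N \ clF N B).card := card_pos.2 ⟨z, hz⟩
  have h7 : rk N (gr N) ≤ rk N ((gr N).erase z) + 1 :=
    rk_le_rk_erase_add_one (Subset.refl _) (mem_sdiff.1 hz).1
  rw [rk_clF, hBrk] at h1
  omega

/-- **Coloop-free: a line with `ν + 2` points is the whole ground set.** -/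
theorem clF_eq_gr_of_card_add_rk_eq (hcf : ∀ z ∈ gr N, rk N ((gr N).erase z) = rk N (gr N))
    {B : Finset α} (hB : B ∈ Rq N 2) (heq : (clF N B).card + rk N (gr N) = (gr N).card + 2) :
    clF N B = gr N := by
  apply Subset.antisymm (clF_subset_gr B)
  intro z hz
  by_contra hzcl
  have h := coloop_of_card_add_rk_eq hB heq (mem_sdiff.2 ⟨hz, hzcl⟩)
  rw [hcf z hz] at h
  omega

/-- **THE OPEN CORE**: on a coloop-free matroid with no line of exactly `ν + 1` points, `(I_t)` holds at co-rank
`3` for every `t ≥ 2` — the family can only fail on a coloop-free matroid with a line of EXACTLY `ν(N) + 1` points. -/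
theorem thresholdIneq_three_of_no_long_line (hcf : ∀ z ∈ gr N, rk N ((gr N).erase z) = rk N (gr N))
    (hlong : ∀ B ∈ Rq N 2, (clF N B).card + rk N (gr N) ≠ (gr N).card + 1) (ht : 2 ≤ t) :
    ThresholdIneq N 3 t := by
  rcases lt_or_ge (rk N (gr N)) 3 with hR | hR
  · -- rank `≤ 2`: the family is empty
    unfold ThresholdIneq thresholdSum
    have hzero : ∀ B ∈ Rq N (3 - 1), (if t + 1 ≤ rk N (gr N \ B) then rk N (gr N \ B) else 0) = 0 := by
      intro B _
      rw [if_neg]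
      have := rk_mono' (M := N) (sdiff_subset : gr N \ B ⊆ gr N)
      omega
    rw [sum_congr rfl hzero, sum_const_zero]
    exact Nat.zero_le _
  · apply thresholdIneq_three_of_line_card_le_nullity
    intro B hB
    have h1 := card_clF_add_rk_le hB
    have h2 := hlong B hB
    rcases lt_or_eq_of_le h1 with hlt | heq
    · omega
    · -- a line with `ν + 2` points is `E`, of rank `≥ 3 ≠ 2`
      have hF := clF_eq_gr_of_card_add_rk_eq hcf hB heq
      have hBrk : rk N B = 2 := rk_eq_of_eRk_eq_cq (mem_Rq.1 hB).2
      have := rk_clF (M := N) B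
      rw [hF, hBrk] at this
      omega

/-- **Outside a long line, every two points form a cocircuit**: for `#(cl B) + ρ(E) = #E + 1` on a coloop-free
matroid and distinct `x, y ∉ cl B`, `ρ(E ∖ {x, y}) + 1 = ρ(E)`. -/
theorem rk_sdiff_pair_of_long_line (hcf : ∀ z ∈ gr N, rk N ((gr N).erase z) = rk N (gr N))
    {B : Finset α} (hB : B ∈ Rq N 2) (hlong : (clF N B).card + rk N (gr N) = (gr N).card + 1)
    {x y : α} (hx : x ∈ gr N \ clF N B) (hy : y ∈ gr N \ clF N B) (hxy : x ≠ y) :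
    rk N (gr N \ {x, y}) + 1 = rk N (gr N) := by
  have hBrk : rk N B = 2 := rk_eq_of_eRk_eq_cq (mem_Rq.1 hB).2
  have hclg : clF N B ⊆ gr N := clF_subset_gr B
  have hpair : ({x, y} : Finset α) ⊆ gr N \ clF N B := insert_subset hx (singleton_subset_iff.2 hy)
  have hsub : gr N \ {x, y} ⊆ clF N B ∪ ((gr N \ clF N B) \ {x, y}) := by
    intro z hz
    rw [mem_sdiff] at hz
    by_cases hzcl : z ∈ clF N B
    · exact mem_union_left _ hzcl
    · exact mem_union_right _ (mem_sdiff.2 ⟨mem_sdiff.2 ⟨hz.1, hzcl⟩, hz.2⟩)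
  have h1 : rk N (gr N \ {x, y}) ≤ rk N (clF N B) + rk N ((gr N \ clF N B) \ {x, y}) :=
    (rk_mono' hsub).trans (rk_union_le _ _)
  have h2 : rk N ((gr N \ clF N B) \ {x, y}) ≤ ((gr N \ clF N B) \ {x, y}).card := rk_le_card _
  have h3 : ((gr N \ clF N B) \ {x, y}).card = (gr N \ clF N B).card - 2 := by
    rw [card_sdiff_of_subset hpair, card_pair hxy]
  have h4 : (gr N \ clF N B).card = (gr N).card - (clF N B).card := card_sdiff_of_subset hclg
  have h5 : (clF N B).card ≤ (gr N).card := card_le_card hclg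
  -- the lower bound: removing two non-coloops drops the rank by at most one
  have hxg : x ∈ gr N := (mem_sdiff.1 hx).1
  have hyg : y ∈ gr N := (mem_sdiff.1 hy).1
  have heq : gr N \ {x, y} = ((gr N).erase x).erase y := by
    ext z
    simp only [mem_sdiff, mem_insert, mem_singleton, mem_erase, not_or]
    tauto
  have h6 : rk N ((gr N).erase x) ≤ rk N (((gr N).erase x).erase y) + 1 :=
    rk_le_rk_erase_add_one (erase_subset _ _) (mem_erase.2 ⟨hxy.symm, hyg⟩)
  rw [← heq] at h6
  rw [rk_clF, hBrk] at h1
  have h7 := hcf x hxg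
  have h8 : 2 ≤ (gr N \ clF N B).card := card_le_card hpair |>.trans' (by rw [card_pair hxy])
  omega

/-- **Outside a long line, `O ∖ x` is independent**: `ρ((E ∖ cl B) ∖ x) = #(E ∖ cl B) − 1` for `x ∉ cl B`
(`ρ(E) = ρ(E ∖ x) ≤ 2 + ρ(O ∖ x)` against `#O = ρ(E) − 1`). -/
theorem rk_sdiff_erase_of_long_line (hcf : ∀ z ∈ gr N, rk N ((gr N).erase z) = rk N (gr N))
    {B : Finset α} (hB : B ∈ Rq N 2) (hlong : (clF N B).card + rk N (gr N) = (gr N).card + 1)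
    {x : α} (hx : x ∈ gr N \ clF N B) :
    rk N ((gr N \ clF N B).erase x) + 1 = (gr N \ clF N B).card := by
  have hBrk : rk N B = 2 := rk_eq_of_eRk_eq_cq (mem_Rq.1 hB).2
  have hclg : clF N B ⊆ gr N := clF_subset_gr B
  have hsub : (gr N).erase x ⊆ clF N B ∪ ((gr N \ clF N B).erase x) := by
    intro y hy
    rw [mem_erase] at hy
    by_cases hycl : y ∈ clF N B
    · exact mem_union_left _ hycl
    · exact mem_union_right _ (mem_erase.2 ⟨hy.1, mem_sdiff.2 ⟨hy.2, hycl⟩⟩)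
  have h1 : rk N ((gr N).erase x) ≤ rk N (clF N B) + rk N ((gr N \ clF N B).erase x) :=
    (rk_mono' hsub).trans (rk_union_le _ _)
  have h2 : rk N ((gr N \ clF N B).erase x) ≤ ((gr N \ clF N B).erase x).card := rk_le_card _
  have h3 : ((gr N \ clF N B).erase x).card = (gr N \ clF N B).card - 1 := card_erase_of_mem hx
  have h4 : (gr N \ clF N B).card = (gr N).card - (clF N B).card := card_sdiff_of_subset hclg
  have h5 : (clF N B).card ≤ (gr N).card := card_le_card hclg
  have h6 : 0 < (gr N \ clF N B).card := card_pos.2 ⟨x, hx⟩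
  rw [rk_clF, hBrk, hcf x (mem_sdiff.1 hx).1] at h1
  omega

/-- **`cl B ∪ (O ∖ x)` has full rank** for a non-coloop `x ∉ cl B` (with `rk_sdiff_erase_of_long_line`: `O ∖ x` is skew
to the long line, `ρ(cl B ∪ (O ∖ x)) = 2 + ρ(O ∖ x)`). -/
theorem rk_union_erase_of_long_line (hcf : ∀ z ∈ gr N, rk N ((gr N).erase z) = rk N (gr N))
    (B : Finset α) {x : α} (hx : x ∈ gr N \ clF N B) :
    rk N (clF N B ∪ (gr N \ clF N B).erase x) = rk N (gr N) := by
  have hclg : clF N B ⊆ gr N := clF_subset_gr B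
  have heq : clF N B ∪ (gr N \ clF N B).erase x = (gr N).erase x := by
    ext y
    simp only [mem_union, mem_erase, mem_sdiff]
    constructor
    · rintro (h | ⟨hyx, hy, _⟩)
      · exact ⟨fun hxy => (mem_sdiff.1 hx).2 (hxy ▸ h), hclg h⟩
      · exact ⟨hyx, hy⟩
    · rintro ⟨hyx, hy⟩
      by_cases hycl : y ∈ clF N B
      · exact Or.inl hycl
      · exact Or.inr ⟨hyx, hy, hycl⟩
  rw [heq, hcf x (mem_sdiff.1 hx).1]

end LongLine

end PercRepro.Cogirth
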